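import Mathlib
import Summits.Ventures.DiscreteObjects.Mahler.SmythIsolationInteger
import Summits.Ventures.DiscreteObjects.Mahler.LehmerExactMeasure
import Summits.Ventures.DiscreteObjects.Mahler.ReciprocalFactorisation
import Summits.Ventures.DiscreteObjects.Mahler.ReciprocalFamilies
import Summits.Ventures.DiscreteObjects.Mahler.LehmerTraceIrreducible

/-!
# Lehmer's polynomial is irreducible (venture `DiscreteObjects`, target L)

Cell `pub-namedobj`, seat `pub-namedobj-mahler` (gen 9). Framing: lottery ticket; floor = certified
bounds/negative ranges.

`L = x¹⁰ + x⁹ - x⁷ - x⁶ - x⁵ - x⁴ - x³ + x + 1` (Lehmer 1933) is irreducible over `ℤ`, so Lehmer's number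
`M(L) = 1.17628…` is an algebraic integer of degree `10` (a Salem number) with minimal polynomial `L`.
Proof (kernel): let `L = A·B` with `A, B` monic.  Since `M(A) ≤ M(L) < 1.1763 < θ₀`, Smyth's theorem
(`intMahlerMeasure_ge_smythTheta_of_nonreciprocal`) forces `A` and `B` to be (anti)reciprocal; as
`L(1) = -1 ≠ 0` and `L(-1) = 1 ≠ 0` they are reciprocal of even degrees `2a`, `2b`.  Writing
`A = x^a Q_A(x + 1/x)`, `B = x^b Q_B(x + 1/x)` (`trace_poly_exists`) and `L = x⁵ Q(x + 1/x)` gives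
`Q = Q_A Q_B` over `ℚ` (equality at infinitely many points `n + 1/n`), and `Q = y⁵+y⁴-5y³-5y²+4y+3` is
irreducible (`irreducible_lehmerTrace`, via `𝔽₂`), so `a = 0` or `b = 0`.

* `lehmerPoly_monic_factor_trivial` — a monic factorisation `L = A·B` has a constant factor;
* `irreducible_lehmerPoly` — **Lehmer's polynomial is irreducible over `ℤ`**.
-/

namespace Summit.Ventures.DiscreteObjects.Mahler

open Polynomial

/-- Basic facts: `deg L = 10`, `L(0) = 1`, `L(1) = -1`, `L(-1) = 1`. -/
theorem lehmerPoly_facts :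
    lehmerPoly.natDegree = 10 ∧ lehmerPoly.coeff 0 = 1 ∧ lehmerPoly.eval 1 = -1 ∧ lehmerPoly.eval (-1) = 1 := by
  unfold lehmerPoly
  refine ⟨by compute_degree!, ?_, ?_, ?_⟩
  · simp [coeff_one, coeff_X]
  · simp
  · simp

/-- A monic factor of Lehmer's polynomial is reciprocal (`A.reverse = A`): by Smyth's theorem a
nonreciprocal factor would have measure `≥ θ₀ > M(L)`, and an antireciprocal one would vanish at `1`. -/
theorem reverse_eq_of_monic_dvd_lehmerPoly {A B : ℤ[X]} (hA : A.Monic) (hB : B.Monic)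
    (h : lehmerPoly = A * B) : A.reverse = A := by
  obtain ⟨_, hL0, hL1, _⟩ := lehmerPoly_facts
  have hA0 : A.coeff 0 ≠ 0 := by
    intro h0
    have := congrArg (fun p : ℤ[X] => p.coeff 0) h
    simp only [mul_coeff_zero, h0, zero_mul, hL0] at this
    exact one_ne_zero this
  -- `M(A) ≤ M(L) < θ₀`
  have hMA : intMahlerMeasure A < smythTheta := by
    have hprod : intMahlerMeasure lehmerPoly = intMahlerMeasure A * intMahlerMeasure B := by
      rw [h, intMahlerMeasure_mul]
    have hB1 := one_le_intMahlerMeasure hB.ne_zero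
    have hA1 := one_le_intMahlerMeasure hA.ne_zero
    have hL := lehmer_measure_upper_bound
    have hθ := smythTheta_gt
    nlinarith
  -- so `A` is reciprocal or antireciprocal
  have hrec : A.reverse = A ∨ A.reverse = -A := by
    by_contra hne
    push Not at hne
    have := intMahlerMeasure_ge_smythTheta_of_nonreciprocal hA0 hne.1 hne.2
    linarith
  rcases hrec with hr | hr
  · exact hr
  · -- antireciprocal: `A(1) = 0`, contradicting `L(1) = -1`
    exfalso
    have h1 := eval_eq_eval_reverse_mul A 1 (by norm_num)
    rw [hr, eval_neg, one_pow, mul_one] at h1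
    have hA1 : A.eval 1 = 0 := by linarith
    have : lehmerPoly.eval 1 = 0 := by rw [h, eval_mul, hA1, zero_mul]
    rw [hL1] at this
    norm_num at this

/-- A monic factor of Lehmer's polynomial has even degree (an odd-degree reciprocal polynomial vanishes
at `-1`, but `L(-1) = 1`). -/
theorem even_natDegree_of_monic_dvd_lehmerPoly {A B : ℤ[X]} (hA : A.Monic) (hB : B.Monic)
    (h : lehmerPoly = A * B) : Even A.natDegree := by
  obtain ⟨_, _, _, hLm1⟩ := lehmerPoly_facts
  have hrev := reverse_eq_of_monic_dvd_lehmerPoly hA hB h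
  by_contra hodd
  rw [Nat.not_even_iff_odd] at hodd
  obtain ⟨d, hd⟩ := hodd
  have hpal := palindromic_of_reverse_eq_self A _ hd hrev
  have hA1 := eval_neg_one_eq_zero_of_palindromic_odd A d hd hpal
  have : lehmerPoly.eval (-1) = 0 := by rw [h, eval_mul, hA1, zero_mul]
  rw [hLm1] at this
  exact one_ne_zero this

/-- **A monic factorisation `L = A·B` of Lehmer's polynomial is trivial.** -/
theorem lehmerPoly_monic_factor_trivial {A B : ℤ[X]} (hA : A.Monic) (hB : B.Monic)
    (h : lehmerPoly = A * B) : A.natDegree = 0 ∨ B.natDegree = 0 := by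
  obtain ⟨hLdeg, _, _, _⟩ := lehmerPoly_facts
  have hrevA := reverse_eq_of_monic_dvd_lehmerPoly hA hB h
  have hrevB := reverse_eq_of_monic_dvd_lehmerPoly hB hA (by rw [h, mul_comm])
  obtain ⟨a, ha⟩ := even_natDegree_of_monic_dvd_lehmerPoly hA hB h
  obtain ⟨b, hb⟩ := even_natDegree_of_monic_dvd_lehmerPoly hB hA (by rw [h, mul_comm])
  rw [← two_mul] at ha hb
  have hab : a + b = 5 := by
    have := congrArg natDegree h
    rw [hA.natDegree_mul hB, hLdeg, ha, hb] at this
    omega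
  -- trace polynomials over `ℚ`
  set AQ := A.map (algebraMap ℤ ℚ) with hAQ
  set BQ := B.map (algebraMap ℤ ℚ) with hBQ
  have hinj : Function.Injective (algebraMap ℤ ℚ) := (algebraMap ℤ ℚ).injective_int
  have hpalA : ∀ j ≤ 2 * a, AQ.coeff j = AQ.coeff (2 * a - j) := by
    intro j hj
    rw [hAQ, coeff_map, coeff_map, palindromic_of_reverse_eq_self A _ ha hrevA j hj]
  have hpalB : ∀ j ≤ 2 * b, BQ.coeff j = BQ.coeff (2 * b - j) := by
    intro j hj
    rw [hBQ, coeff_map, coeff_map, palindromic_of_reverse_eq_self B _ hb hrevB j hj]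
  obtain ⟨QA, hQAdeg, hQAlc, hQAev⟩ := trace_poly_exists a AQ
    (by rw [hAQ, natDegree_map_eq_of_injective hinj, ha]) hpalA
  obtain ⟨QB, hQBdeg, hQBlc, hQBev⟩ := trace_poly_exists b BQ
    (by rw [hBQ, natDegree_map_eq_of_injective hinj, hb]) hpalB
  have hQAlc1 : QA.coeff a = 1 := by
    rw [hQAlc, hAQ, coeff_map, ← ha, hA.coeff_natDegree, map_one]
  have hQBlc1 : QB.coeff b = 1 := by
    rw [hQBlc, hBQ, coeff_map, ← hb, hB.coeff_natDegree, map_one]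
  -- the trace polynomial of `L` over `ℚ` equals `QA * QB`
  set Q : ℤ[X] := X ^ 5 + X ^ 4 - 5 * X ^ 3 - 5 * X ^ 2 + 4 * X + 3 with hQ
  have hQev : ∀ x : ℚ, x ≠ 0 →
      (Q.map (algebraMap ℤ ℚ)).eval (x + x⁻¹) = (QA * QB).eval (x + x⁻¹) := by
    intro x hx
    have hL : (lehmerPoly.map (algebraMap ℤ ℚ)).eval x = x ^ 5 * (Q.map (algebraMap ℤ ℚ)).eval (x + x⁻¹) := by
      have e := lehmer_eval_eq_trace x hx
      unfold lehmerPoly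
      rw [hQ]
      simp only [Polynomial.map_add, Polynomial.map_sub, Polynomial.map_mul, Polynomial.map_pow, map_X,
        Polynomial.map_one, Polynomial.map_ofNat, eval_add, eval_sub, eval_mul, eval_pow, eval_X, eval_one,
        eval_ofNat]
      rw [e]
    have hL' : (lehmerPoly.map (algebraMap ℤ ℚ)).eval x = x ^ 5 * (QA * QB).eval (x + x⁻¹) := by
      rw [h, Polynomial.map_mul, eval_mul, ← hAQ, ← hBQ, hQAev x hx, hQBev x hx, eval_mul, ← hab, pow_add]
      ring
    have hx5 : x ^ 5 ≠ 0 := pow_ne_zero _ hx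
    exact mul_left_cancel₀ hx5 (hL.symm.trans hL')
  have hQeq : Q.map (algebraMap ℤ ℚ) = QA * QB := by
    apply eq_of_infinite_eval_eq
    -- the points `n + 1/n`, `n ≥ 2`, are distinct
    refine Set.infinite_of_injective_forall_mem (f := fun n : ℕ => ((n : ℚ) + 2) + ((n : ℚ) + 2)⁻¹) ?_ ?_
    · intro m n hmn
      simp only at hmn
      have hm : (0 : ℚ) < (m : ℚ) + 2 := by positivity
      have hn : (0 : ℚ) < (n : ℚ) + 2 := by positivity
      have key : (((m : ℚ) + 2) - ((n : ℚ) + 2)) * (((m : ℚ) + 2) * ((n : ℚ) + 2) - 1) = 0 := by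
        field_simp at hmn
        linear_combination hmn
      rcases mul_eq_zero.mp key with h1 | h1
      · exact_mod_cast (by linarith : (m : ℚ) = n)
      · exfalso
        have : (4 : ℚ) ≤ ((m : ℚ) + 2) * ((n : ℚ) + 2) := by nlinarith
        linarith
    · intro n
      exact hQev _ (by positivity)
  -- `Q` is irreducible over `ℚ`, hence `QA` or `QB` is a unit
  have hQm : Q.Monic := by rw [hQ]; monicity!
  have hQirrQ : Irreducible (Q.map (algebraMap ℤ ℚ)) :=
    (hQm.irreducible_iff_irreducible_map_fraction_map (K := ℚ)).mp (by rw [hQ]; exact irreducible_lehmerTrace)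
  rw [hQeq] at hQirrQ
  rcases hQirrQ.isUnit_or_isUnit rfl with hu | hu
  · left
    have h0 := natDegree_eq_zero_of_isUnit hu
    have : a ≤ QA.natDegree := le_natDegree_of_ne_zero (by rw [hQAlc1]; exact one_ne_zero)
    omega
  · right
    have h0 := natDegree_eq_zero_of_isUnit hu
    have : b ≤ QB.natDegree := le_natDegree_of_ne_zero (by rw [hQBlc1]; exact one_ne_zero)
    omega

/-- **Lehmer's polynomial `x¹⁰ + x⁹ - x⁷ - x⁶ - x⁵ - x⁴ - x³ + x + 1` is irreducible over `ℤ`**; hence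
Lehmer's number `M(L) = 1.17628…` is an algebraic integer of degree `10`. -/
theorem irreducible_lehmerPoly : Irreducible lehmerPoly := by
  obtain ⟨hLdeg, _, _, _⟩ := lehmerPoly_facts
  refine irreducible_iff.mpr ⟨fun hu => ?_, fun A B hAB => ?_⟩
  · have := natDegree_eq_zero_of_isUnit hu
    omega
  -- leading coefficients `±1`; normalise to monic factors
  have hlc : A.leadingCoeff * B.leadingCoeff = 1 := by
    rw [← leadingCoeff_mul, ← hAB]; exact lehmerPoly_monic.leadingCoeff
  set u := A.leadingCoeff with hu
  set v := B.leadingCoeff with hv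
  have hu1 : u * u = 1 := by rcases Int.eq_one_or_neg_one_of_mul_eq_one hlc with h | h <;> rw [h] <;> norm_num
  have hv1 : v * v = 1 := by
    rcases Int.eq_one_or_neg_one_of_mul_eq_one (by rw [mul_comm]; exact hlc) with h | h <;> rw [h] <;> norm_num
  have hA0 : A ≠ 0 := by intro h0; rw [h0, leadingCoeff_zero] at hu; rw [hu, zero_mul] at hu1; exact zero_ne_one hu1
  have hB0 : B ≠ 0 := by intro h0; rw [h0, leadingCoeff_zero] at hv; rw [hv, zero_mul] at hv1; exact zero_ne_one hv1
  have hAm : (C u * A).Monic := by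
    rw [Monic, leadingCoeff_mul, leadingCoeff_C, ← hu, hu1]
  have hBm : (C v * B).Monic := by
    rw [Monic, leadingCoeff_mul, leadingCoeff_C, ← hv, hv1]
  have hfac : lehmerPoly = (C u * A) * (C v * B) := by
    rw [hAB]
    have : C u * C v = (1 : ℤ[X]) := by rw [← map_mul, hlc, map_one]
    linear_combination (-(A * B)) * this
  have hu0 : u ≠ 0 := by intro h0; rw [h0, zero_mul] at hu1; exact zero_ne_one hu1
  have hv0 : v ≠ 0 := by intro h0; rw [h0, zero_mul] at hv1; exact zero_ne_one hv1
  rcases lehmerPoly_monic_factor_trivial hAm hBm hfac with h | h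
  · left
    rw [natDegree_C_mul hu0] at h
    rw [eq_C_of_natDegree_eq_zero h, isUnit_C]
    have : A.coeff 0 = u := by
      rw [hu, leadingCoeff, h]
    rw [this]
    exact isUnit_iff_exists_inv.mpr ⟨u, hu1⟩
  · right
    rw [natDegree_C_mul hv0] at h
    rw [eq_C_of_natDegree_eq_zero h, isUnit_C]
    have : B.coeff 0 = v := by
      rw [hv, leadingCoeff, h]
    rw [this]
    exact isUnit_iff_exists_inv.mpr ⟨v, hv1⟩

end Summit.Ventures.DiscreteObjects.Mahler
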